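import Literature.Probability.RandomPlanarGeometry.SlitTimeChange
import Literature.Probability.RandomPlanarGeometry.LoewnerIdentification
import Literature.Probability.RandomPlanarGeometry.RestrictionDensitySlit
import HarnessLib

/-!
# Loewner's theorem for slits (Lawler's Prop. 4.4) and [LSW] Lemma 3.5, density of `𝒜₀`

G. F. Lawler, *Conformally Invariant Processes in the Plane*, AMS (2005), Prop. 4.4: "Suppose
`γ` is a simple curve as above [`γ(0) ∈ ℝ`, `γ(0, ∞) ⊂ ℍ`] such that `b(t)` is `C¹` … Then
for `z ∈ ℍ`, `g_t(z)` is the solution of the initial value problem `ġ_t(z) = ḃ(t)/(g_t(z) - U_t)`,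
`g_0(z) = z`, where `U_t = g_t(γ(t))`. If `z = γ(t₀)`, then this holds for `t < t₀` and
`U_{t₀} = lim_{t → t₀-} g_t(z)`", proof: "If `s ≥ 0` and `z ∈ H_s`, then Proposition 3.46
implies … `lim_{ε → 0+} (g_{s+ε}(z) - g_s(z))/ε = ḃ(s)/(g_s(z) - U_s)`. Since `g_t(z)` is continuous
in `t` and `U_t, ḃ(t)` are continuous, this implies that `g_t` satisfies (4.3), see Lemma 4.3. The
remaining assertions follow from Theorem 4.6", with Remark 4.5 (parametrization by capacity,
`ḃ ≡ 2`). For a slit from a positive real point (`IsPlusSlit γ` on `[0, 1]`) this file PROVES,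
in capacity time (`SlitTimeChange`: `σ`, `W_t = U_{σ(t)}`, `flow t z = g_{σ(t)}(z)`):

* `IsPlusSlit.hasDerivWithinAt_flow_Ici` — the RIGHT derivative `2/(g - W_t)` of `t ↦ g_{σ(t)}(z)`
  (the increment expansion `SlitCapacity.norm_gmap_sub_gmap_sub_div_le`, i.e. Prop. 3.46, with
  the uniform local growth);
* `IsPlusSlit.hasDerivWithinAt_flow` — the Loewner equation on `[0, b(u*)/2]` for `z` off
  `γ[0, u*]` (continuity in `t` by Lawler's Lemma 4.1, then Lemma 4.3,
  `hasDerivWithinAt_Icc_of_hasDerivWithinAt_Ici`);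
* `IsPlusSlit.tendsto_flow_sub_driving` — **(4.2): `g_{σ(t)}(γ(s)) - W_t → 0` as `t ↑ b(s)/2`**
  (the uniform local growth in its other variable);
* `IsPlusSlit.hull_driving` — **`Loewner.hull W S = γ(0, 1]`** (`Loewner.hull_eq_of_flow`),
  `IsPlusSlit.closure_hull_driving` — `closure (K_S) = γ[0, 1]`, and
  `IsPlusSlit.exists_continuous_driving` — **Loewner's theorem for slits**: `γ[0, 1]` is the closed
  hull at a positive time of the chordal Loewner chain of a continuous driving function with
  `W_0 = γ(0) > 0`;
* `exists_continuous_driving_of_slit` — the same for a slit parametrized by `[0, u]`, and hence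
  **`IsArcHull.exists_isLSWGenerated_lswClosedConverges_holds`**: the named fact of
  `RestrictionDensityArc` ([LSW] Lemma 3.5, the hulls `E_δ` are limits of `𝒜₀`) is PROVED, by
  `IsArcHull.exists_isLSWGenerated_lswClosedConverges_of_slit` (`RestrictionDensitySlit`).

## References

* G. F. Lawler (2005), §4.1: Lemma 4.1–4.3, Prop. 4.4, Remark 4.5, Thm. 4.6 [Lawler2005].
* [LSW] proof of Lemma 3.5, p. 13 [LawlerSchrammWerner2003Restriction].
-/

noncomputable section

open Set Filter Metric Complex Bornology Function
open _root_.Topology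
open UpperHalfPlane (upperHalfPlaneSet isOpen_upperHalfPlaneSet)
open scoped NNReal

namespace Literature.Probability.RandomPlanarGeometry

namespace IsPlusSlit

variable {γ : ℝ → ℂ} (h : IsPlusSlit γ)

/-! ### The flow on `[0, b(u*)/2]` for points off `γ[0, u*]` -/

/-- `flow t z = g_{σ(t)}(z)` with prescribed proof arguments (proof irrelevance). [folklore] -/
theorem flow_eq' {t : ℝ} (ht0 : 0 < t) (htS : t ≤ h.capTime) (p : 0 < h.timeChange t)
    (q : h.timeChange t ≤ 1) (z : ℂ) : h.flow t z = h.gmap p q z := by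
  rw [h.flow_eq ht0 htS]

/-- `σ(t) ≤ u*` for `t ≤ b(u*)/2`. [folklore] -/
theorem timeChange_le_of_le {us t : ℝ} (hus : us ∈ Icc (0 : ℝ) 1) (ht0 : 0 ≤ t) (ht : t ≤ h.cap us / 2) :
    h.timeChange t ≤ us := by
  have hT : h.cap us / 2 ≤ h.capTime := by
    rw [capTime]; linarith [h.strictMonoOn_cap.monotoneOn hus ⟨zero_le_one, le_rfl⟩ hus.2]
  have := h.strictMonoOn_timeChange.monotoneOn ⟨ht0, ht.trans hT⟩ ⟨by linarith [h.cap_nonneg hus.1 hus.2], hT⟩ ht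
  rwa [h.timeChange_cap_div_two hus] at this

/-- `b(u*)/2 ≤ S`. [folklore] -/
theorem cap_div_two_le_capTime {us : ℝ} (hus : us ∈ Icc (0 : ℝ) 1) : h.cap us / 2 ≤ h.capTime := by
  rw [capTime]; linarith [h.strictMonoOn_cap.monotoneOn hus ⟨zero_le_one, le_rfl⟩ hus.2]

/-- Points off `γ[0, u*]` stay off `γ[0, σ(t)]` for `t ≤ b(u*)/2`. [folklore] -/
theorem mem_diff_hull_timeChange {us t : ℝ} (hus : us ∈ Icc (0 : ℝ) 1) (ht0 : 0 ≤ t) (ht : t ≤ h.cap us / 2)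
    {z : ℂ} (hz : z ∈ upperHalfPlaneSet \ h.hull us) : z ∈ upperHalfPlaneSet \ h.hull (h.timeChange t) :=
  h.diff_subset_diff (h.timeChange_le_of_le hus ht0 ht) hz

/-- **The flow stays in `ℍ`** for `z` off `γ[0, u*]` and `t ∈ [0, b(u*)/2]`. [folklore] -/
theorem flow_mem {us : ℝ} (hus : us ∈ Icc (0 : ℝ) 1) {z : ℂ} (hz : z ∈ upperHalfPlaneSet \ h.hull us)
    {t : ℝ} (ht : t ∈ Icc 0 (h.cap us / 2)) : h.flow t z ∈ upperHalfPlaneSet := by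
  rcases ht.1.eq_or_lt with heq | ht0
  · rw [← heq, h.flow_zero]; exact hz.1
  · rw [h.flow_eq ht0 (ht.2.trans (h.cap_div_two_le_capTime hus))]
    exact (h.gmap _ _).mapsTo (h.mem_diff_hull_timeChange hus ht.1 ht.2 hz)

/-- `σ(t) < u₀ + δ` for `t` slightly above `t₀` (continuity of `σ`). [folklore] -/
theorem eventually_timeChange_lt {t₀ : ℝ} (ht₀ : t₀ ∈ Icc 0 h.capTime) {δ : ℝ} (hδ : 0 < δ) :
    ∃ η : ℝ, 0 < η ∧ ∀ t ∈ Icc 0 h.capTime, |t - t₀| < η → |h.timeChange t - h.timeChange t₀| < δ := by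
  obtain ⟨η, hη, hmod⟩ := h.exists_forall_abs_timeChange_sub_le (half_pos hδ)
  exact ⟨η, hη, fun t ht htt ↦ (hmod t ht t₀ ht₀ htt).trans_lt (half_lt_self hδ)⟩

/-- The algebra of the difference quotient: `s⁻¹ X - 2/Y = (X - 2s/Y)/s`. [folklore] -/
theorem slope_identity {X Y : ℂ} {s : ℝ} (hs : s ≠ 0) :
    ((s⁻¹ : ℝ) : ℂ) * X - 2 / Y = (X - ((2 * s : ℝ) : ℂ) / Y) / (s : ℂ) := by
  have hs' : (s : ℂ) ≠ 0 := by exact_mod_cast hs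
  push_cast
  field_simp

/-- **The right derivative of the flow is `2/(g - W_t)`** at every `t₀ ∈ [0, b(u*)/2)` for `z` off
`γ[0, u*]` (Lawler's display in the proof of Prop. 4.4: Prop. 3.46 for the increment map
`g_{u₀,u}` about `U_{u₀}`, radius the uniform local growth; at `t₀ = 0`, Prop. 3.46 for `g_u`
about `γ(0)`). [cite: Lawler2005, Prop. 4.4 (proof)] -/
theorem hasDerivWithinAt_flow_Ici {us : ℝ} (hus : us ∈ Ioc (0 : ℝ) 1) {z : ℂ}
    (hz : z ∈ upperHalfPlaneSet \ h.hull us) {t₀ : ℝ} (ht₀ : t₀ ∈ Ico 0 (h.cap us / 2)) :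
    HasDerivWithinAt (fun t ↦ h.flow t z) (2 / (h.flow t₀ z - h.driving t₀.toNNReal)) (Ici t₀) t₀ := by
  have hus' : us ∈ Icc (0 : ℝ) 1 := ⟨hus.1.le, hus.2⟩
  have hT : h.cap us / 2 ≤ h.capTime := h.cap_div_two_le_capTime hus'
  have ht₀S : t₀ < h.capTime := ht₀.2.trans_le hT
  rw [hasDerivWithinAt_iff_tendsto_slope, Ici_sdiff_left, Metric.tendsto_nhds]
  intro ε hε
  rcases ht₀.1.eq_or_lt with heq | ht₀pos
  · -- `t₀ = 0`: expansion of `g_u` itself about `x₀ = γ(0)`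
    subst heq
    set x₀ : ℝ := (γ 0).re with hx₀
    have hW0 : h.driving (0 : ℝ).toNNReal = x₀ := by simp [h.driving_zero, hx₀]
    rw [h.flow_zero, hW0]
    have hd : 0 < ‖z - x₀‖ := by
      refine norm_pos_iff.2 (sub_ne_zero.2 fun heq ↦ ?_)
      have : z.im = 0 := by rw [heq, ofReal_im]
      exact absurd this (ne_of_gt hz.1)
    set d : ℝ := ‖z - x₀‖ with hddef
    -- the radius `r` and the time window
    set r : ℝ := min (d / 2) (ε * d ^ 2 / 48) with hr
    have hrpos : 0 < r := lt_min (by positivity) (by positivity)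
    have hr2 : 2 * r ≤ d := by linarith [min_le_left (d / 2) (ε * d ^ 2 / 48)]
    have hrε : 12 * r / d ^ 2 ≤ ε / 4 := by
      rw [div_le_iff₀ (by positivity)]
      have := min_le_right (d / 2) (ε * d ^ 2 / 48)
      linarith
    obtain ⟨δ₂, hδ₂, hγδ⟩ := h.exists_forall_norm_sub_lt hrpos
    obtain ⟨η, hη, hσ⟩ := h.eventually_timeChange_lt ⟨le_rfl, h.capTime_pos.le⟩ hδ₂
    have hwin : Ioo 0 (min η (h.cap us / 2)) ∈ 𝓝[>] (0 : ℝ) :=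
      Ioo_mem_nhdsGT (lt_min hη (by linarith [h.cap_pos hus.1 hus.2]))
    filter_upwards [hwin] with t ht
    have ht0 : 0 < t := ht.1
    have htT : t < h.cap us / 2 := ht.2.trans_le (min_le_right _ _)
    have htS : t ≤ h.capTime := (htT.le.trans hT)
    set u : ℝ := h.timeChange t with hu
    have hupos : 0 < u := h.timeChange_pos ht0 htS
    have hu1 : u ≤ 1 := (h.timeChange_mem ⟨ht0.le, htS⟩).2
    have huδ : u < δ₂ := by
      have := hσ t ⟨ht0.le, htS⟩ (by rw [sub_zero, abs_of_pos ht0]; exact ht.2.trans_le (min_le_left _ _))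
      rw [h.timeChange_zero, sub_zero] at this
      exact lt_of_abs_lt this
    have hzu : z ∈ upperHalfPlaneSet \ h.hull u := h.mem_diff_hull_timeChange hus' ht0.le htT.le hz
    have hsub : h.hull u ∩ upperHalfPlaneSet ⊆ closedBall ((x₀ : ℝ) : ℂ) r := by
      rintro _ ⟨⟨s, hs, rfl⟩, -⟩
      rw [mem_closedBall, dist_eq_norm, hx₀, h.ofReal_re_zero]
      exact (hγδ s ⟨hs.1, hs.2.trans hu1⟩ 0 ⟨le_rfl, zero_le_one⟩
        (by rw [sub_zero, abs_of_nonneg hs.1]; exact hs.2.trans_lt huδ)).le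
    have hcap : h.cap u = 2 * t := h.cap_timeChange ⟨ht0.le, htS⟩
    have key := (h.isHydrodynamicMap_gmap hupos hu1).norm_sub_sub_div_le hsub hrpos hz.1 hr2
    rw [← h.cap_eq hupos hu1, hcap] at key
    -- the slope
    rw [slope_def_module]
    rw [h.flow_zero, sub_zero, h.flow_eq' ht0 htS hupos hu1, dist_eq_norm, Complex.real_smul,
      slope_identity ht0.ne', norm_div, Complex.norm_real, Real.norm_eq_abs, abs_of_pos ht0, div_lt_iff₀ ht0]
    refine key.trans_lt ?_
    rw [← hddef]
    have : 6 * (2 * t) * r / d ^ 2 = t * (12 * r / d ^ 2) := by ring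
    rw [this]
    calc t * (12 * r / d ^ 2) ≤ t * (ε / 4) := mul_le_mul_of_nonneg_left hrε ht0.le
      _ < ε * t := by linarith [mul_pos hε ht0]
  · -- `t₀ > 0`: expansion of the increment map about `U_{u₀}`
    set u₀ : ℝ := h.timeChange t₀ with hu₀
    have hu₀pos : 0 < u₀ := h.timeChange_pos ht₀pos ht₀S.le
    have hu₀1 : u₀ < 1 := h.timeChange_lt_one ht₀.1 ht₀S
    have hW : h.driving t₀.toNNReal = h.drive u₀ := h.driving_toNNReal ht₀pos ht₀S
    have hwH : h.gmap hu₀pos hu₀1.le z ∈ upperHalfPlaneSet :=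
      (h.gmap hu₀pos hu₀1.le).mapsTo (h.mem_diff_hull_timeChange hus' ht₀.1 ht₀.2.le hz)
    have hd : 0 < ‖h.gmap hu₀pos hu₀1.le z - h.drive u₀‖ := by
      refine norm_pos_iff.2 (sub_ne_zero.2 fun heq ↦ ?_)
      have : (h.gmap hu₀pos hu₀1.le z).im = 0 := by rw [heq, ofReal_im]
      exact absurd this (ne_of_gt hwH)
    set d : ℝ := ‖h.gmap hu₀pos hu₀1.le z - h.drive u₀‖ with hddef
    set ρ : ℝ := min (d / 2) (ε * d ^ 2 / 48) with hρ
    have hρpos : 0 < ρ := lt_min (by positivity) (by positivity)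
    have hρ2 : 2 * ρ ≤ d := by linarith [min_le_left (d / 2) (ε * d ^ 2 / 48)]
    have hρε : 12 * ρ / d ^ 2 ≤ ε / 4 := by
      rw [div_le_iff₀ (by positivity)]
      have := min_le_right (d / 2) (ε * d ^ 2 / 48)
      linarith
    obtain ⟨δ₁, hδ₁, hgrowth⟩ := h.uniform_local_growth hρpos
    obtain ⟨η, hη, hσ⟩ := h.eventually_timeChange_lt ⟨ht₀.1, ht₀S.le⟩ hδ₁
    have hwin : Ioo t₀ (min (t₀ + η) (h.cap us / 2)) ∈ 𝓝[>] t₀ :=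
      Ioo_mem_nhdsGT (lt_min (by linarith) ht₀.2)
    filter_upwards [hwin] with t ht
    have ht0 : 0 < t := ht₀pos.trans ht.1
    have htT : t < h.cap us / 2 := ht.2.trans_le (min_le_right _ _)
    have htS : t ≤ h.capTime := htT.le.trans hT
    set u : ℝ := h.timeChange t with hu
    have hu1 : u ≤ 1 := (h.timeChange_mem ⟨ht0.le, htS⟩).2
    have hu₀u : u₀ < u := h.strictMonoOn_timeChange ⟨ht₀.1, ht₀S.le⟩ ⟨ht0.le, htS⟩ ht.1
    have huδ : u < u₀ + δ₁ := by
      have := hσ t ⟨ht0.le, htS⟩ (by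
        rw [abs_of_pos (by linarith [ht.1])]; linarith [ht.2, min_le_left (t₀ + η) (h.cap us / 2)])
      linarith [(abs_lt.1 this).2]
    have hzu : z ∈ upperHalfPlaneSet \ h.hull u := h.mem_diff_hull_timeChange hus' ht0.le htT.le hz
    have hgr : ∀ s ∈ Ioc u₀ u, ‖h.ext u₀ (γ s) - h.landing u₀‖ ≤ ρ := fun s hs ↦
      hgrowth u₀ hu₀pos hu₀1 s hs.1 (hs.2.trans hu1) (lt_of_le_of_lt hs.2 huδ)
    have key := h.norm_gmap_sub_gmap_sub_div_le hu₀pos hu₀1 hu₀u hu1 hρpos hgr hzu hρ2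
    have hcap : (h.cap u - h.cap u₀ : ℝ) = 2 * (t - t₀) := by
      rw [h.cap_timeChange ⟨ht0.le, htS⟩, h.cap_timeChange ⟨ht₀.1, ht₀S.le⟩]; ring
    have htt : 0 < t - t₀ := by linarith [ht.1]
    rw [slope_def_module]
    rw [h.flow_eq' ht0 htS (hu₀pos.trans hu₀u) hu1, h.flow_eq' ht₀pos ht₀S.le hu₀pos hu₀1.le, hW,
      dist_eq_norm, Complex.real_smul, slope_identity htt.ne', norm_div, Complex.norm_real,
      Real.norm_eq_abs, abs_of_pos htt, div_lt_iff₀ htt]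
    have key' : ‖h.gmap (hu₀pos.trans hu₀u) hu1 z - h.gmap hu₀pos hu₀1.le z -
        ((2 * (t - t₀) : ℝ) : ℂ) / (h.gmap hu₀pos hu₀1.le z - h.drive u₀)‖ ≤
        6 * (2 * (t - t₀)) * ρ / d ^ 2 := by
      rw [hddef, ← hcap]
      push_cast at key ⊢
      exact key
    refine key'.trans_lt ?_
    have : 6 * (2 * (t - t₀)) * ρ / d ^ 2 = (t - t₀) * (12 * ρ / d ^ 2) := by ring
    rw [this]
    calc (t - t₀) * (12 * ρ / d ^ 2) ≤ (t - t₀) * (ε / 4) := mul_le_mul_of_nonneg_left hρε htt.le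
      _ < ε * (t - t₀) := by linarith [mul_pos hε htt]

/-- **Lawler's Lemma 4.1 in capacity time: `t ↦ g_{σ(t)}(z)` is (uniformly) continuous** on
`[0, b(u*)/2]` for `z` off `γ[0, u*]`. [cite: Lawler2005, Lemma 4.1] -/
theorem continuousOn_flow {us : ℝ} (hus : us ∈ Ioc (0 : ℝ) 1) {z : ℂ} (hz : z ∈ upperHalfPlaneSet \ h.hull us) :
    ContinuousOn (fun t ↦ h.flow t z) (Icc 0 (h.cap us / 2)) := by
  have hus' : us ∈ Icc (0 : ℝ) 1 := ⟨hus.1.le, hus.2⟩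
  have hT : h.cap us / 2 ≤ h.capTime := h.cap_div_two_le_capTime hus'
  -- a uniform modulus: `‖flow t' z - flow t z‖ ≤ ε/2` for `0 ≤ t ≤ t'`, `t' - t < η`
  have hunif : ∀ ε > 0, ∃ η > 0, ∀ t ∈ Icc 0 (h.cap us / 2), ∀ t' ∈ Icc 0 (h.cap us / 2), t ≤ t' → t' - t < η →
      ‖h.flow t' z - h.flow t z‖ < ε := by
    intro ε hε
    obtain ⟨δ₁, hδ₁, hgrowth⟩ := h.uniform_local_growth (show 0 < ε / 581 by positivity)
    obtain ⟨δ₂, hδ₂, hγδ⟩ := h.exists_forall_norm_sub_lt (show 0 < ε / 19 by positivity)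
    obtain ⟨η, hη, hmod⟩ := h.exists_forall_abs_timeChange_sub_le (half_pos (lt_min hδ₁ hδ₂))
    refine ⟨η, hη, fun t ht t' ht' htt' hη' ↦ ?_⟩
    rcases htt'.eq_or_lt with rfl | hlt
    · simp [hε]
    have ht'0 : 0 < t' := ht.1.trans_lt hlt
    have ht'S : t' ≤ h.capTime := ht'.2.trans hT
    set u' : ℝ := h.timeChange t' with hu'
    have hu'pos : 0 < u' := h.timeChange_pos ht'0 ht'S
    have hu'1 : u' ≤ 1 := (h.timeChange_mem ⟨ht'0.le, ht'S⟩).2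
    have hzu' : z ∈ upperHalfPlaneSet \ h.hull u' := h.mem_diff_hull_timeChange hus' ht'.1 ht'.2 hz
    have hσ : |u' - h.timeChange t| < min δ₁ δ₂ := by
      have := hmod t' ⟨ht'.1, ht'S⟩ t ⟨ht.1, ht.2.trans hT⟩ (by rw [abs_of_pos (by linarith)]; exact hη')
      exact this.trans_lt (half_lt_self (lt_min hδ₁ hδ₂))
    rcases ht.1.eq_or_lt with heq | htpos
    · -- from `t = 0`
      rw [← heq, h.flow_zero, h.flow_eq' ht'0 ht'S hu'pos hu'1]
      rw [← heq, h.timeChange_zero, sub_zero, abs_of_pos hu'pos] at hσ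
      have hsub : h.hull u' ⊆ closedBall (((γ 0).re : ℝ) : ℂ) (ε / 19) := by
        rintro _ ⟨s, hs, rfl⟩
        rw [mem_closedBall, dist_eq_norm, h.ofReal_re_zero]
        exact (hγδ s ⟨hs.1, hs.2.trans hu'1⟩ 0 ⟨le_rfl, zero_le_one⟩
          (by rw [sub_zero, abs_of_nonneg hs.1]; exact hs.2.trans_lt (hσ.trans_le (min_le_right _ _)))).le
      have := h.norm_gmap_sub_self_le hu'pos hu'1 (show 0 < ε / 19 by positivity) hsub hzu'
      linarith
    · set u : ℝ := h.timeChange t with hu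
      have htS : t ≤ h.capTime := ht.2.trans hT
      have hupos : 0 < u := h.timeChange_pos htpos htS
      have hu1 : u < 1 := h.timeChange_lt_one ht.1 (hlt.trans_le ht'S)
      have huu' : u < u' := h.strictMonoOn_timeChange ⟨ht.1, htS⟩ ⟨ht'.1, ht'S⟩ hlt
      have hgr : ∀ s ∈ Ioc u u', ‖h.ext u (γ s) - h.landing u‖ ≤ ε / 581 := fun s hs ↦
        hgrowth u hupos hu1 s hs.1 (hs.2.trans hu'1) (by
          have := (abs_lt.1 (hσ.trans_le (min_le_left _ _))).2
          linarith [hs.2])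
      rw [h.flow_eq' ht'0 ht'S (hupos.trans huu') hu'1, h.flow_eq' htpos htS hupos hu1.le]
      have := h.norm_gmap_sub_gmap_le hupos hu1 huu' hu'1 (show 0 < ε / 581 by positivity) hgr hzu'
      linarith
  rw [Metric.continuousOn_iff]
  intro t ht ε hε
  obtain ⟨η, hη, hmod⟩ := hunif ε hε
  refine ⟨η, hη, fun t' ht' htt' ↦ ?_⟩
  rw [dist_eq_norm]
  rw [Real.dist_eq] at htt'
  rcases le_total t t' with hle | hle
  · exact hmod t ht t' ht' hle (by linarith [(abs_lt.1 htt').2])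
  · rw [norm_sub_rev]; exact hmod t' ht' t ht hle (by linarith [(abs_lt.1 htt').1])

/-- The right-hand side `2/(g_{σ(t)}(z) - W_t)` is continuous on `[0, b(u*)/2]`. [folklore] -/
theorem continuousOn_field {us : ℝ} (hus : us ∈ Ioc (0 : ℝ) 1) {z : ℂ} (hz : z ∈ upperHalfPlaneSet \ h.hull us) :
    ContinuousOn (fun t : ℝ ↦ (2 : ℂ) / (h.flow t z - h.driving t.toNNReal)) (Icc 0 (h.cap us / 2)) := by
  have hW : Continuous fun t : ℝ ↦ ((h.driving t.toNNReal : ℝ) : ℂ) :=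
    Complex.continuous_ofReal.comp (h.continuous_driving.comp continuous_real_toNNReal)
  refine continuousOn_const.div ((h.continuousOn_flow hus hz).sub hW.continuousOn) fun t ht heq ↦ ?_
  have hmem := h.flow_mem ⟨hus.1.le, hus.2⟩ hz ht
  have : (h.flow t z).im = 0 := by rw [sub_eq_zero.1 heq, ofReal_im]
  exact absurd this (ne_of_gt hmem)

/-- **The Loewner equation for the slit** (Prop. 4.4 with Remark 4.5): for `z` off `γ[0, u*]`,
`t ↦ g_{σ(t)}(z)` has derivative `2/(g_{σ(t)}(z) - W_t)` within `[0, b(u*)/2]` at every point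
(Lemma 4.3 applied to the continuous flow with its continuous right derivative).
[cite: Lawler2005, Prop. 4.4] -/
theorem hasDerivWithinAt_flow {us : ℝ} (hus : us ∈ Ioc (0 : ℝ) 1) {z : ℂ}
    (hz : z ∈ upperHalfPlaneSet \ h.hull us) {t : ℝ} (ht : t ∈ Icc 0 (h.cap us / 2)) :
    HasDerivWithinAt (fun s ↦ h.flow s z) (2 / (h.flow t z - h.driving t.toNNReal)) (Icc 0 (h.cap us / 2)) t :=
  hasDerivWithinAt_Icc_of_hasDerivWithinAt_Ici (by linarith [h.cap_pos hus.1 hus.2])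
    (h.continuousOn_flow hus hz) (h.continuousOn_field hus hz)
    (fun t₀ ht₀ ↦ h.hasDerivWithinAt_flow_Ici hus hz ht₀) ht

/-! ### Points of the slit: solutions up to their capacity time, hitting the driving function -/

/-- **The point `γ(s)` flows as a solution up to its capacity time `b(s)/2`.** [cite: Lawler2005, Prop. 4.4 (z = γ(t₀))] -/
theorem isSolution_flow_apply {s : ℝ} (hs : s ∈ Ioc (0 : ℝ) 1) :
    Loewner.IsSolution h.driving (γ s) (fun t ↦ h.flow t (γ s)) ((h.cap s / 2).toNNReal : ℝ≥0) := by
  have hτ : 0 < h.cap s / 2 := by linarith [h.cap_pos hs.1 hs.2]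
  have hcoe : (((h.cap s / 2).toNNReal : ℝ≥0) : ℝ) = h.cap s / 2 := Real.coe_toNNReal _ hτ.le
  refine Loewner.isSolution_of_hasDerivWithinAt (h.flow_zero _) (fun t ht ↦ ?_) (fun t ht ↦ ?_)
  · rw [hcoe] at ht ⊢
    -- an intermediate parameter `u* ∈ (σ(t), s)`
    set us : ℝ := (h.timeChange t + s) / 2 with hus
    have htS : t ≤ h.capTime := ht.2.le.trans (h.cap_div_two_le_capTime ⟨hs.1.le, hs.2⟩)
    have hσs : h.timeChange t < s := by
      have := h.strictMonoOn_timeChange ⟨ht.1, htS⟩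
        ⟨hτ.le, h.cap_div_two_le_capTime ⟨hs.1.le, hs.2⟩⟩ ht.2
      rwa [h.timeChange_cap_div_two ⟨hs.1.le, hs.2⟩] at this
    have hσ0 : 0 ≤ h.timeChange t := (h.timeChange_mem ⟨ht.1, htS⟩).1
    have hus0 : 0 < us := by rw [hus]; linarith [hs.1]
    have huss : us < s := by rw [hus]; linarith
    have hus1 : us ≤ 1 := huss.le.trans hs.2
    have hz : γ s ∈ upperHalfPlaneSet \ h.hull us := h.apply_mem_diff hus0.le huss hs.2
    have htT : t < h.cap us / 2 := by
      have : h.cap (h.timeChange t) < h.cap us :=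
        h.strictMonoOn_cap (h.timeChange_mem ⟨ht.1, htS⟩) ⟨hus0.le, hus1⟩ (by rw [hus]; linarith)
      rw [h.cap_timeChange ⟨ht.1, htS⟩] at this
      linarith
    have hder := h.hasDerivWithinAt_flow ⟨hus0, hus1⟩ hz ⟨ht.1, htT.le⟩
    refine hder.mono_of_mem_nhdsWithin ?_
    have h1 : Iio (h.cap us / 2) ∈ 𝓝 t := Iio_mem_nhds htT
    refine mem_of_superset (inter_mem_nhdsWithin _ h1) ?_
    rintro t' ⟨ht', ht'lt⟩
    exact ⟨ht'.1, le_of_lt ht'lt⟩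
  · rw [hcoe] at ht
    set us : ℝ := (h.timeChange t + s) / 2 with hus
    have htS : t ≤ h.capTime := ht.2.le.trans (h.cap_div_two_le_capTime ⟨hs.1.le, hs.2⟩)
    have hσs : h.timeChange t < s := by
      have := h.strictMonoOn_timeChange ⟨ht.1, htS⟩
        ⟨hτ.le, h.cap_div_two_le_capTime ⟨hs.1.le, hs.2⟩⟩ ht.2
      rwa [h.timeChange_cap_div_two ⟨hs.1.le, hs.2⟩] at this
    have hus0 : 0 < us := by rw [hus]; linarith [hs.1, (h.timeChange_mem ⟨ht.1, htS⟩).1]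
    have huss : us < s := by rw [hus]; linarith
    have hus1 : us ≤ 1 := huss.le.trans hs.2
    have hz : γ s ∈ upperHalfPlaneSet \ h.hull us := h.apply_mem_diff hus0.le huss hs.2
    have htT : t < h.cap us / 2 := by
      have : h.cap (h.timeChange t) < h.cap us :=
        h.strictMonoOn_cap (h.timeChange_mem ⟨ht.1, htS⟩) ⟨hus0.le, hus1⟩ (by rw [hus]; linarith)
      rw [h.cap_timeChange ⟨ht.1, htS⟩] at this
      linarith
    exact h.flow_mem ⟨hus0.le, hus1⟩ hz ⟨ht.1, htT.le⟩

/-- **(4.2): `g_{σ(t)}(γ(s)) - W_t → 0` as `t ↑ b(s)/2`** — the point `γ(s)` hits the driving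
function at its capacity time (the uniform local growth: `g_u(γ s) - U_u = E_u(γ s) - Ũ_u` is
small once `u` is close to `s` from below). [cite: Lawler2005, Prop. 4.4 (U_{t₀} = lim g_t(z))] -/
theorem tendsto_flow_sub_driving {s : ℝ} (hs : s ∈ Ioc (0 : ℝ) 1) :
    Tendsto (fun t : ℝ ↦ h.flow t (γ s) - h.driving t.toNNReal) (𝓝[<] (h.cap s / 2)) (𝓝 0) := by
  set τ : ℝ := h.cap s / 2 with hτ
  have hτpos : 0 < τ := by rw [hτ]; linarith [h.cap_pos hs.1 hs.2]
  have hτS : τ ≤ h.capTime := h.cap_div_two_le_capTime ⟨hs.1.le, hs.2⟩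
  have hστ : h.timeChange τ = s := h.timeChange_cap_div_two ⟨hs.1.le, hs.2⟩
  rw [Metric.tendsto_nhds]
  intro ε hε
  obtain ⟨δ₁, hδ₁, hgrowth⟩ := h.uniform_local_growth (half_pos hε)
  obtain ⟨η, hη, hσ⟩ := h.eventually_timeChange_lt ⟨hτpos.le, hτS⟩ hδ₁
  have hwin : Ioo (max 0 (τ - η)) τ ∈ 𝓝[<] τ := Ioo_mem_nhdsLT (max_lt hτpos (by linarith))
  filter_upwards [hwin] with t ht
  have ht0 : 0 < t := (le_max_left _ _).trans_lt ht.1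
  have htη : τ - η < t := (le_max_right _ _).trans_lt ht.1
  have htS : t < h.capTime := ht.2.trans_le hτS
  set u : ℝ := h.timeChange t with hu
  have hupos : 0 < u := h.timeChange_pos ht0 htS.le
  have hu1 : u < 1 := h.timeChange_lt_one ht0.le htS
  have hus : u < s := by
    have := h.strictMonoOn_timeChange ⟨ht0.le, htS.le⟩ ⟨hτpos.le, hτS⟩ ht.2
    rwa [hστ] at this
  have hsu : s < u + δ₁ := by
    have := hσ t ⟨ht0.le, htS.le⟩ (by rw [abs_lt]; constructor <;> linarith [ht.2])
    rw [hστ] at this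
    linarith [(abs_lt.1 this).1]
  rw [dist_zero_right, h.flow_eq' ht0 htS.le hupos hu1.le, h.driving_toNNReal ht0 htS,
    h.gmap_apply_sub_drive hupos hu1 hus hs.2]
  exact (hgrowth u hupos hu1 s hus hs.2 hsu).trans_lt (half_lt_self hε)

/-! ### The hull of the chain is the slit -/

/-- The terminal capacity time as an element of `ℝ≥0`. [folklore] -/
def capTimeNN : ℝ≥0 := ⟨h.capTime, h.capTime_pos.le⟩

/-- `(capTimeNN : ℝ) = S`. [folklore] -/
@[simp] theorem coe_capTimeNN : (h.capTimeNN : ℝ) = h.capTime := rfl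

/-- **`Loewner.hull W S = γ(0, 1]`**: the hull of the chordal Loewner chain driven by `W` at the
terminal capacity time is the slit (`Loewner.hull_eq_of_flow` with the flow `g_{σ(t)}`).
[cite: Lawler2005, Prop. 4.4 with Thm. 4.6] -/
theorem hull_driving : Loewner.hull h.driving h.capTimeNN = γ '' Ioc 0 1 := by
  have hK : γ '' Ioc 0 1 ⊆ upperHalfPlaneSet := by
    rintro _ ⟨s, hs, rfl⟩; exact h.im_pos s hs
  refine Loewner.hull_eq_of_flow h.continuous_driving (show (0 : ℝ≥0) < h.capTimeNN from h.capTime_pos) hK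
    (G := h.flow) (fun z ↦ h.flow_zero z) (fun z hz ↦ ?_) (fun z hz ↦ ?_)
  · -- off the slit: the equation on `[0, S]` with values in `ℍ`
    have hz1 : z ∈ upperHalfPlaneSet \ h.hull 1 := by
      refine ⟨hz.1, fun hmem ↦ hz.2 ?_⟩
      obtain ⟨s, hs, rfl⟩ := hmem
      rcases hs.1.eq_or_lt with heq | hpos
      · exact absurd (heq ▸ h.im_zero : (γ s).im = 0) (ne_of_gt hz.1)
      · exact ⟨s, ⟨hpos, hs.2⟩, rfl⟩
    have hS : h.cap 1 / 2 = (h.capTimeNN : ℝ) := rfl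
    refine ⟨fun t ht ↦ ?_, fun t ht ↦ ?_⟩
    · have := h.hasDerivWithinAt_flow ⟨one_pos, le_rfl⟩ hz1 (t := t) (by rwa [hS])
      rwa [hS] at this
    · exact h.flow_mem ⟨zero_le_one, le_rfl⟩ hz1 (by rwa [hS])
  · -- on the slit: hit at the capacity time
    obtain ⟨s, hs, rfl⟩ := hz
    have hτ : 0 < h.cap s / 2 := by linarith [h.cap_pos hs.1 hs.2]
    refine ⟨(h.cap s / 2).toNNReal, by simpa using hτ, ?_, h.isSolution_flow_apply hs, ?_⟩
    · show (h.cap s / 2).toNNReal ≤ h.capTimeNN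
      rw [← NNReal.coe_le_coe, Real.coe_toNNReal _ hτ.le, coe_capTimeNN]
      exact h.cap_div_two_le_capTime ⟨hs.1.le, hs.2⟩
    · rw [Real.coe_toNNReal _ hτ.le]
      exact h.tendsto_flow_sub_driving hs

/-- **`closure (K_S) = γ[0, 1]`.** [cite: Lawler2005, Prop. 4.4] -/
theorem closure_hull_driving : closure (Loewner.hull h.driving h.capTimeNN) = γ '' Icc 0 1 := by
  rw [h.hull_driving, ← slit_inter_upperHalfPlaneSet one_pos h.im_zero h.im_pos,
    closure_slit_inter one_pos h.continuousOn h.im_zero h.im_pos]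

include h in
/-- **Loewner's theorem for slits** (Lawler (2005), Prop. 4.4 with Remark 4.5 and Thm. 4.6, for
a simple curve `γ : [0, 1] → ℍ̄` from the positive real point `γ(0)` with `γ(0, 1] ⊆ ℍ`): there
are a continuous driving function `W` with `W_0 = γ(0) > 0` and a time `S > 0` such that the
closed hull of the chordal Loewner chain of `W` at time `S` is the slit `γ[0, 1]`.
[cite: Lawler2005, Prop. 4.4] -/
theorem exists_continuous_driving :
    ∃ (W : ℝ≥0 → ℝ) (S : ℝ≥0), Continuous W ∧ 0 < S ∧ 0 < W 0 ∧ closure (Loewner.hull W S) = γ '' Icc 0 1 :=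
  ⟨h.driving, h.capTimeNN, h.continuous_driving, h.capTime_pos, h.driving_zero_pos, h.closure_hull_driving⟩

end IsPlusSlit

/-! ### [LSW] Lemma 3.5: the named fact -/

/-- **Loewner's theorem for a slit parametrized by `[0, u]`** (`u > 0`): rescale to `[0, 1]`.
[cite: Lawler2005, Prop. 4.4] -/
theorem exists_continuous_driving_of_slit {γ : ℝ → ℂ} {u : ℝ} (hu : 0 < u)
    (hγc : ContinuousOn γ (Icc 0 u)) (hγi : InjOn γ (Icc 0 u)) (h0 : (γ 0).im = 0)
    (h0re : 0 < (γ 0).re) (hpos : ∀ t ∈ Ioc 0 u, 0 < (γ t).im) :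
    ∃ (W : ℝ≥0 → ℝ) (S : ℝ≥0), Continuous W ∧ 0 < S ∧ 0 < W 0 ∧
      closure (Loewner.hull W S) = γ '' Icc 0 u := by
  set γ' : ℝ → ℂ := fun s ↦ γ (u * s) with hγ'
  have hmaps : ∀ s ∈ Icc (0 : ℝ) 1, u * s ∈ Icc 0 u := fun s hs ↦
    ⟨mul_nonneg hu.le hs.1, mul_le_of_le_one_right hu.le hs.2⟩
  have h' : IsPlusSlit γ' :=
    { continuousOn := hγc.comp (continuousOn_const.mul continuousOn_id) hmaps
      injOn := fun s hs s' hs' heq ↦ by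
        have := hγi (hmaps s hs) (hmaps s' hs') heq
        exact mul_left_cancel₀ hu.ne' this
      im_zero := by simp [hγ', h0]
      re_pos := by simp [hγ', h0re]
      im_pos := fun t ht ↦ hpos (u * t) ⟨mul_pos hu ht.1, mul_le_of_le_one_right hu.le ht.2⟩ }
  obtain ⟨W, S, hW, hS, hW0, hK⟩ := h'.exists_continuous_driving
  refine ⟨W, S, hW, hS, hW0, ?_⟩
  rw [hK, hγ', show (fun s : ℝ ↦ γ (u * s)) = γ ∘ (fun s : ℝ ↦ u * s) from rfl, image_comp]
  congr 1
  ext y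
  constructor
  · rintro ⟨s, hs, rfl⟩; exact hmaps s hs
  · intro hy
    refine ⟨y / u, ⟨div_nonneg hy.1 hu.le, div_le_one_of_le₀ hy.2 hu.le⟩, ?_⟩
    show u * (y / u) = y
    field_simp

/-- **[LSW] Lemma 3.5, the hulls `E_δ` are limits of `𝒜₀`** — the named fact
`IsArcHull.exists_isLSWGenerated_lswClosedConverges` of `RestrictionDensityArc` is PROVED
(Loewner's theorem for slits, `exists_continuous_driving_of_slit`, fed to
`IsArcHull.exists_isLSWGenerated_lswClosedConverges_of_slit`).
[cite: LawlerSchrammWerner2003Restriction, proof of Lemma 3.5 (p. 13)] -/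
theorem IsArcHull.exists_isLSWGenerated_lswClosedConverges_holds :
    IsArcHull.exists_isLSWGenerated_lswClosedConverges :=
  IsArcHull.exists_isLSWGenerated_lswClosedConverges_of_slit fun hu hγc hγi h0 h0re hpos ↦
    exists_continuous_driving_of_slit hu hγc hγi h0 h0re hpos

end Literature.Probability.RandomPlanarGeometry
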